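import Mathlib
import HarnessLib
import Summits.CriticalPhenomena.PercolationContinuityZ3.Theses.PercLowPointHalfSpace
import Summits.CriticalPhenomena.PercolationContinuityZ3.Theorems.PercLowPointHalfSpaceLowPointBookkeepingOfSharpStubs
import Summits.CriticalPhenomena.PercolationContinuityZ3.Theorems.PercLowPointHalfSpaceLowPointBookkeepingSharpReduce
import Summits.CriticalPhenomena.PercolationContinuityZ3.Theorems.PercLowPointHalfSpaceLowPointBookkeepingSharpDominatesLog

/-!
# Skeleton `floor-russo` for the crux `LowPointBookkeeping` (stmt-CriticalPhenomena-14713) — rev c2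

Line SketchIdeator1 (cards `floor-density-russo-pair-overlap` + `tail-to-decoration-markov-split`,
crux-ideate ideator 1), continuation lead c2 (2026-08-17).  K = `A → B → C → [P_{p_c}(0 ↔ n e₀) → 0]`.

## Status of the line

Everything except the two inputs is LANDED sorry-free in `Theorems/`:

* steps 1–6 of the composition (column telescoping, floor term by qualitative BGN, integrated Russo
  inequality in the floor density, pivot translation, window pair count, Markov truncation fed by
  Hutchcroft's universal tightness, window average → `θ(p_c)=0` → axis decay) are the helper files
  `…StubPivotTranslation` (p99363), `…StubDilutionToolkit` (p100771), `…StubPairCount` (p102908),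
  `…StubPairExpectation` (p112051, Aux p107148, Aux2 p107591), `…StubFloorCoupling` (p116033, Labels
  p114905, Cluster p115018, Pivot p115663) and the glue `…Glue` (p119274), `…OfSharpStubs` (p119553):
  `FloorRusso.Glue.lowPointBookkeeping_of_sharp : (A♯ₛ) → (B♯) → LowPointBookkeeping`;
* rev c2 reduces the two inputs to CANONICAL single-instance forms (`…SharpReduce`, p134668:
  `Reduce.twoArmSharpFloor_of_e1`, `Reduce.noFatHalfBox_of_origin`) and records that they DOMINATE the
  route's own cruxes: A♯ₛ ⇒ A (`Glue.boundaryTwoArmDecay_of_sharp`), B♯ ⇒ B up to `log r`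
  (`…SharpDominatesLog`, p134403: `Dominates.tallClusterMassBound_log_of_noFatHalfBox`) and B♯ with any
  exponent `m < 11/4` ⇒ B exactly (`…SharpDominatesExp`: `Dominates.tallClusterMassBound_of_noFatHalfBox_exp`).

## The two registered stubs (sorries live ONLY here) = the two OPEN hypotheses

* `stub_twoArmSharpFloorE1` (A♯ₛ): the route's crux-A event verbatim (two ℍ-disjoint `r`-tall clusters
  from the adjacent floor roots `0` and `e = (0,1,0)`), with exponent `11/4 + κ` instead of `5/2 + κ`,
  under the floor-diluted critical half-space measure `P^{ℍ}_{p_c,s}` uniformly in `s ∈ [0,1]`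
  (at `s = 1` this is `P_{p_c}`: `floorDiluted_one_real_twoArm`);
* `stub_noFatHalfBoxOrigin` (B♯): the largest `ℍ`-cluster trace in the half-box `B_n ∩ ℍ` is typically
  at most `C n^{11/4}`: `P^{ℍ}_{p_c,1}(|K_max(B_n ∩ ℍ)| ≥ C n^{11/4}) ≤ e^{-1}` for all `n ≥ 1`.

Both are open problems of 3D critical percolation (real world `a₂ ≈ 3 > 11/4 > d_f ≈ 2.52`; MC kit
j015667/j015398/j019390); neither follows from A, B, C as typed (far regime of the pair count needs
`a₂ > m`; tails for rooted clusters need the UNROOTED typical `K_max` by Hutchcroft's splitting, so B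
is idle; A's `5/2 < 11/4`).  Crux C is not used (the floor term needs only qualitative BGN); A and B as
typed are not used.  Honest reading: K ⇐ A♯ₛ ∧ B♯, and (A♯ₛ, B♯) ⇒ (A, B): the planner's restatement
A ↦ A♯ₛ, B ↦ B♯ loses nothing of the route.
-/

noncomputable section

open MeasureTheory Filter Topology
open Literature.Probability.Percolation Literature.Probability.LatticeModels
open scoped ENNReal

namespace Summit.CriticalPhenomena.PercolationContinuityZ3.Theorems.FloorRusso

open Summit.CriticalPhenomena.PercolationContinuityZ3.Theses.PercLowPointHalfSpace

/-! ## Registered stubs (sorries live ONLY here) -/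

/-- **stub_twoArmSharpFloorE1 (A♯ₛ, canonical form; OPEN hypothesis)**: under `P^{ℍ}_{p_c,s}`, uniformly
in the floor density `s`, the probability that `C_ℍ(0)` and `C_ℍ(e)`, `e = (0,1,0)`, are ℍ-disjoint and
both reach sup-distance `r` is `≤ C r^{-(11/4+κ)}` for some `κ > 0` (the route's crux-A event verbatim,
exponent `11/4 + κ`; saturation prediction `a₂ = 3`, MC `a₂(s) = 2.90–2.97` flat in `s`, kit j015667). -/
theorem stub_twoArmSharpFloorE1 :
    ∃ κ C : ℝ, 0 < κ ∧ ∀ s : unitInterval, ∀ r : ℕ, 1 ≤ r →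
      (floorDilutedPercolation 3 (criticalProbI 3) s).real
        ({ω | ∃ y : Site 3, (∃ i : Fin 3, ((r : ℕ) : ℤ) ≤ |y i|) ∧ ω ∈ openConnIn {x : Site 3 | 0 ≤ x 0} 0 y} ∩ {ω | ∃ y : Site 3, (∃ i : Fin 3, ((r : ℕ) : ℤ) ≤ |y i - (Pi.single 1 1 : Site 3) i|) ∧ ω ∈ openConnIn {x : Site 3 | 0 ≤ x 0} (Pi.single 1 1) y} ∩ (openConnIn {x : Site 3 | 0 ≤ x 0} 0 (Pi.single 1 1))ᶜ) ≤ C * (r : ℝ) ^ (-(11 / 4 + κ)) := by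
  sorry

/-- **stub_noFatHalfBoxOrigin (B♯, canonical form; OPEN hypothesis)**: at `p_c(ℤ³)`, on the induced
half-space graph (`P^{ℍ}_{p_c,1}`), the largest ℍ-cluster trace in the half-box `B_n ∩ ℍ` has
`≥ C n^{11/4}` vertices with probability `≤ 1/e`, for all `n ≥ 1` (real world `n^{d_f} = n^{2.52}`;
MC kit j019390: holds with `C = 2` for `n ≤ 48`). -/
theorem stub_noFatHalfBoxOrigin :
    ∃ C : ℝ, 0 < C ∧ ∀ n : ℕ, 1 ≤ n →
      (floorDilutedPercolation 3 (criticalProbI 3) 1).real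
        {ω | C * (n : ℝ) ^ ((11 : ℝ) / 4) ≤ (clusterMaxIn ((box 3 n).filter fun z : Site 3 => 0 ≤ z 0) ω : ℝ)}
          ≤ Real.exp (-1) := by
  sorry

/-! ## Composition (everything below is glue through LANDED files) -/

/-- The registered four-neighbour form A♯ₛ from the canonical stub (`Reduce.twoArmSharpFloor_of_e1`,
lattice symmetries fixing the height). -/
theorem twoArmSharpFloor_all :
    ∃ κ C : ℝ, 0 < κ ∧ ∀ s : unitInterval, ∀ e ∈ ({Pi.single 1 1, Pi.single 1 (-1), Pi.single 2 1, Pi.single 2 (-1)} : Finset (Site 3)), ∀ r : ℕ, 1 ≤ r →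
      (floorDilutedPercolation 3 (criticalProbI 3) s).real
        ({ω | ∃ y : Site 3, (∃ i : Fin 3, ((r : ℕ) : ℤ) ≤ |y i|) ∧ ω ∈ openConnIn {x : Site 3 | 0 ≤ x 0} 0 y} ∩ {ω | ∃ y : Site 3, (∃ i : Fin 3, ((r : ℕ) : ℤ) ≤ |y i - e i|) ∧ ω ∈ openConnIn {x : Site 3 | 0 ≤ x 0} e y} ∩ (openConnIn {x : Site 3 | 0 ≤ x 0} 0 e)ᶜ) ≤ C * (r : ℝ) ^ (-(11 / 4 + κ)) :=
  Reduce.twoArmSharpFloor_of_e1 stub_twoArmSharpFloorE1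

/-- The registered five-box form B♯ from the canonical stub (`Reduce.noFatHalfBox_of_origin`). -/
theorem noFatHalfBox_all :
    ∃ C : ℝ, 0 < C ∧ ∀ x ∈ insert (0 : Site 3) ({Pi.single 1 1, Pi.single 1 (-1), Pi.single 2 1, Pi.single 2 (-1)} : Finset (Site 3)), ∀ n : ℕ, 1 ≤ n →
      (floorDilutedPercolation 3 (criticalProbI 3) 1).real
        {ω | C * (n : ℝ) ^ ((11 : ℝ) / 4) ≤ (clusterMaxIn (((box 3 n).image fun y : Site 3 => x + y).filter fun z : Site 3 => 0 ≤ z 0) ω : ℝ)}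
          ≤ Real.exp (-1) :=
  Reduce.noFatHalfBox_of_origin stub_noFatHalfBoxOrigin

/-- **`θ(p_c(ℤ³)) = 0` from the two stubs** (window average of `τ`, `θ² ≤ τ`). -/
theorem percolationContinuityZ3_of_stubs : _root_.PercolationContinuityZ3 :=
  Glue.percolationContinuityZ3_of_sharp twoArmSharpFloor_all noFatHalfBox_all

/-- **Composition: the crux `LowPointBookkeeping` from the two stubs** (A, B, C as typed are not used;
the axis conclusion follows from `θ(p_c) = 0` through the landed column-sum equivalence). -/
theorem LowPointBookkeeping_of : LowPointBookkeeping :=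
  Glue.lowPointBookkeeping_of_sharp twoArmSharpFloor_all noFatHalfBox_all

/-! ## The stubs dominate the route's cruxes A and B -/

/-- A♯ₛ ⇒ A: the route's `BoundaryTwoArmDecay` from the canonical two-arm stub. -/
theorem boundaryTwoArmDecay_of_stubs : BoundaryTwoArmDecay :=
  Glue.boundaryTwoArmDecay_of_sharp twoArmSharpFloor_all

/-- B♯ ⇒ B up to `log r`: the route's `TallClusterMassBound` with a factor `1 + log r` from the
canonical no-fat-half-box stub (`Dominates.tallClusterMassBound_log_of_noFatHalfBox`). -/
theorem tallClusterMassBound_log_of_stubs :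
    ∃ C : ℝ, ∀ r : ℕ, 1 ≤ r →
      ∑ x ∈ box 3 r, (bondPercolation (zdGraph 3) (criticalProbI 3)).real (openConnIn {x : Site 3 | 0 ≤ x 0} 0 x ∩
          {ω | ∃ y : Site 3, (∃ i : Fin 3, (r : ℤ) ≤ |y i|) ∧ ω ∈ openConnIn {x : Site 3 | 0 ≤ x 0} 0 y}) ≤
        C * (r : ℝ) ^ ((11 : ℝ) / 4) * (1 + Real.log r) *
          (bondPercolation (zdGraph 3) (criticalProbI 3)).real {ω | ∃ y : Site 3, (∃ i : Fin 3, (r : ℤ) ≤ |y i|) ∧ ω ∈ openConnIn {x : Site 3 | 0 ≤ x 0} 0 y} :=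
  Dominates.tallClusterMassBound_log_of_noFatHalfBox noFatHalfBox_all

/-- The route's `Assembly` (A → B → C → θ(p_c) = 0) from the two stubs. -/
theorem assembly_of_stubs : Assembly :=
  Glue.assembly_of_sharp twoArmSharpFloor_all noFatHalfBox_all

end Summit.CriticalPhenomena.PercolationContinuityZ3.Theorems.FloorRusso

end
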